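import Summits.QuantumFields.YangMills.Theorems.BalabanUVNodesN15KingModelAnalyticBlockField
import Summits.QuantumFields.YangMills.Theorems.BalabanUVNodesN15KingModelAnalyticCauchy
import Mathlib.Analysis.Complex.Liouville
import Mathlib.Analysis.Calculus.MeanValue
import HarnessLib

/-!
# BalabanUVNodes ∕ N15 — THE KING-MODEL RUNG (PART Ϩ-m): KING's (4.34)(ii) IS LIPSCHITZ IN THE BACKGROUND, `η`-UNIFORMLY, WITH ITS DECAY — the entries of the continued sandwich
# `Q(U)G(U,V)Q♯_K(V)` and of `Δ_eff(U,V)` are HOLOMORPHIC functions of the link variables (on the locus ∕ along print's slice on Bałaban's polydisc), and Cauchy's estimate on the scalar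
# bilinear entries `u†·blk(Q G Q♯_K)·u′` along the complex line through two unitary fields gives ★★★★ `‖blk(Δ_eff(U₁) − Δ_eff(U₀)) y y′‖ ≤ a²(16∕κ)e³(Lε∕s₀)·e^{−ctRate(κ∕2,a,d)d_M(y,y′)}`
# (`‖U₁ − U₀‖ ≤ ε`, `2Lε ≤ s₀(κ,a,d)`) — the tree's `effLaplacian_decay` shape for the DIFFERENCE, linear in `ε∕η` (PART Ϧ-l's operator-norm Lipschitz bound had no decay)
# (Track A, DAG node N15 = NE2; FAN-OUT v1.1 §N15 s3 «KING-MODEL RUNG … + what the curved case adds»; count-neutral)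

HONEST FRAMING.  Count-neutral (cell `pub-ymgap`, seat `pub-ymgap-dag-n15-e` g51; `--supports stmt-QuantumFields-27247 --as helper` = K3ᴬ, KEY MAP v3).  King's one-level comparison model;
analyticity over `𝕜`, Cauchy at `𝕜 = ℂ`; inputs PART Ϩ-g∕h∕l.  NOT the block-field covariance `(Δ_eff)⁻¹`; NOT Bałaban's multi-level objects; NOT a node discharge (N15 of record untouched);
nothing continuum ∕ ℝ⁴ ∕ OS ∕ Clay.

THE RESULTS:
* §1 ENTRYWISE HOLOMORPHY: def `entryCLMn` (fibre-matrix entry read-out); ★ `analyticAt_covQ_entry`, ★ `analyticAt_cxKingQadj_entry` (polynomial), ★★ `analyticAt_cxSandwich_entry` (on the locus),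
  ★★ `analyticAt_cxEffLap_entry`, ★★★ **`analyticAt_printEffLap_entry`** (every entry of `U ↦ Δ_eff(U,U⁻¹)` is analytic at every `U` of the closed polydisc `Lε ≤ s₀` around a unitary `κ`-coercive `U₀`).
* §2 (`𝕜 = ℂ`) THE SCALAR BILINEAR ENTRY ALONG THE LINE `U₀ + tδU`: `bilin_eq_sum`, ★ `differentiableAt_bilin_printLine`, ★ `norm_bilin_printLine_le` (`≤ (8∕κ)e³e^{−δd_M}‖u‖‖u′‖`, `|t| ≤ R`),
  ★★ `norm_deriv_bilin_printLine_le` (Cauchy on the half disc), ★★★ `norm_bilin_printSandwich_sub_le` (`R ≥ 2`: `≤ (16∕κ)e³e^{−δd_M}‖u‖‖u′‖∕R`).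
* §3 ★★★ **`norm_blk_sandwich_sub_le_eta_uniform`** (unitary `U₀,U₁`, `‖U₁−U₀‖ ≤ ε`, `0 < ε`, `2Lε ≤ s₀`: `‖blk(Q(U₁)A₀(U₁)⁻¹Q(U₁)^* − Q(U₀)A₀(U₀)⁻¹Q(U₀)^*) y y′‖ ≤ (16∕κ)e³(Lε∕s₀)e^{−ctRate(κ∕2,a,d)d_M(y,y′)}`),
  ★★★★ **`norm_blk_effLapU_sub_le_eta_uniform`** (`‖blk(Δ_eff(U₁) − Δ_eff(U₀)) y y′‖ ≤ a²(16∕κ)e³(Lε∕s₀)e^{−ctRate(κ∕2,a,d)d_M(y,y′)}` — KING's (4.34)(ii), LIPSCHITZ IN THE BACKGROUND ON BAŁABAN's SCALE WITH DECAY),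
  ★★★ `norm_blk_effLapU_sub_le_small_curvature` (constants (m²,a,d,ε₀) only).
PRIOR TREE ART (by name): Ϩ-l (`cxKingQadj`, `cxEffLap`, `blk_cxEffLap`, `cxEffLap_inv_of_unitary`, `norm_blk_cxSandwich_at_radius_le`), Ϩ-h (`analyticAt_treeHol`, `analyticAt_treeHolRev`, `analyticAt_cxFullOp_inv_entry`,
`analyticAt_sliceEmbed`), Ϩ-g (`sliceRadius`, `sliceRadius_pos∕_le`, `isUnit_cxFullOp_at_radius`), Ϩ-f (`isUnit_of_near_unitary`), Ϧ-e (`l2_opNorm_le_of_bilinear`), Ϥ-o (`re_quadForm_fullOpU_ge_uniform_of_small_curvature`),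
Mathlib (`Complex.norm_deriv_le_of_forall_mem_sphere_norm_le`, `Convex.norm_image_sub_le_of_norm_deriv_le`, `Finset.analyticAt_sum`, `AnalyticAt.mul`).  Dedup (rg at filing): basename 0 files; needles
`analyticAt_covQ_entry|bilin_printLine|norm_blk_effLapU_sub_le_eta_uniform` 0 tree files.  Locators: [King1986] (2.14) p.653, (4.34) p.674; [Balaban1985BackgroundPropagators] Thm 3.4 p.400, (3.48)–(3.50) pp.398–400;
[Dimock2013] App. D (coin).  0 `sorry`, 1 `def`.
-/

noncomputable section
open scoped BigOperators ComplexConjugate ComplexOrder Topology Matrix.Norms.L2Operator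
open Finset Matrix Filter Metric Set WithLp

namespace Summit.QuantumFields.YangMills.BalabanUVNodes.N15KingModelRung.Analytic

open Literature.MathematicalPhysics.QuantumFieldTheory.LatticeDiamagneticInequality (blk)
open Literature.MathematicalPhysics.QuantumFieldTheory.Balaban1983to89.B5Prop11Plancherel (Tor fine unitVec)
open Literature.MathematicalPhysics.QuantumFieldTheory.King1986.Torus (site tdistT)
open Summit.QuantumFields.YangMills.BalabanUVNodes.N15KingModelRung.Covariant (CxLinks fib blk_sub' blk_smul')
open Summit.QuantumFields.YangMills.BalabanUVNodes.N15KingModelRung.CovariantBlock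
  (BlockTree kingComb kingComb_depth_le covQ kingQadjU fullOpU effLapU re_quadForm_fullOpU_ge_uniform_of_small_curvature)
open Summit.QuantumFields.YangMills.BalabanUVNodes.N15KingModelRung.CombesThomas (ctRate l2_opNorm_le_of_bilinear norm_star_dotProduct_le_fibre blk_effLapU)
open Summit.QuantumFields.YangMills.BalabanUVNodes.N15KingModelRung.Cover (kingPlaq)

variable {d : ℕ} {L : ℕ} [NeZero L] (T : BlockTree d L) (M : Fin (d + 1) → ℕ) [hM : ∀ μ, NeZero (M μ)]
variable {𝕜 : Type*} [RCLike 𝕜] {n : Type*} [Fintype n] [DecidableEq n]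

/-! ## §1 Entrywise holomorphy of the sandwich and of `Δ_eff(U,V)` -/

section Entries

variable (𝕜) in
/-- The entry read-out `A ↦ A i k` on fibre matrices, as a CLM. [folklore] -/
def entryCLMn (i k : n) : Matrix n n 𝕜 →L[𝕜] 𝕜 :=
  LinearMap.toContinuousLinearMap { toFun := fun A => A i k, map_add' := fun _ _ => rfl, map_smul' := fun _ _ => rfl }

/-- ★ THE ENTRIES OF `Q(U)` ARE ANALYTIC in the two-sided field (polynomials in the forward variables). [cite: Balaban1985BackgroundPropagators, (3.19) p.393, §3.B p.399 l.37–40] -/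
theorem analyticAt_covQ_entry (p : Tor M × n) (q : Tor (fine L M) × n) (UV₀ : CxLinks (fine L M) 𝕜 n) :
    AnalyticAt 𝕜 (fun UV : CxLinks (fine L M) 𝕜 n => covQ T M UV.1 p q) UV₀ := by
  unfold covQ
  refine Finset.analyticAt_fun_sum _ fun j _ => ?_
  by_cases h : q.1 = site L M p.1 j
  · simp only [if_pos h]
    exact analyticAt_const.mul (((entryCLMn 𝕜 p.2 q.2).analyticAt _).comp (analyticAt_treeHol T M p.1 UV₀ j))
  · simp only [if_neg h]; exact analyticAt_const

/-- ★ THE ENTRIES OF `Q♯_K(V)` ARE ANALYTIC (polynomials in the backward variables). [cite: Balaban1985BackgroundPropagators, (3.19) p.393, §3.B p.399 l.37–40] -/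
theorem analyticAt_cxKingQadj_entry (q : Tor (fine L M) × n) (p : Tor M × n) (UV₀ : CxLinks (fine L M) 𝕜 n) :
    AnalyticAt 𝕜 (fun UV : CxLinks (fine L M) 𝕜 n => cxKingQadj T M UV.2 q p) UV₀ := by
  unfold cxKingQadj cxQadj
  simp only [Matrix.smul_apply, smul_eq_mul]
  refine analyticAt_const.mul (Finset.analyticAt_fun_sum _ fun j _ => ?_)
  by_cases h : q.1 = site L M p.1 j
  · simp only [if_pos h]
    exact analyticAt_const.mul (((entryCLMn 𝕜 q.2 p.2).analyticAt _).comp (analyticAt_treeHolRev T M p.1 UV₀ j))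
  · simp only [if_neg h]; exact analyticAt_const

/-- ★★ **THE ENTRIES OF THE CONTINUED SANDWICH `Q(U)G(U,V)Q♯_K(V)` ARE ANALYTIC** at every point of the invertibility locus (finite sums of products).
[cite: Balaban1985BackgroundPropagators, Thm 3.4 p.400; King1986, (2.14) p.653] -/
theorem analyticAt_cxSandwich_entry {a c m2 : ℝ} {UV₀ : CxLinks (fine L M) 𝕜 n} (hU : IsUnit (cxFullOp T M a c m2 UV₀.1 UV₀.2)) (p p' : Tor M × n) :
    AnalyticAt 𝕜 (fun UV : CxLinks (fine L M) 𝕜 n => (covQ T M UV.1 * (cxFullOp T M a c m2 UV.1 UV.2)⁻¹ * cxKingQadj T M UV.2) p p') UV₀ := by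
  simp only [Matrix.mul_apply]
  refine Finset.analyticAt_fun_sum _ fun s _ => ?_
  refine (Finset.analyticAt_fun_sum _ fun r _ => ?_).mul (analyticAt_cxKingQadj_entry T M s p' UV₀)
  exact (analyticAt_covQ_entry T M p r UV₀).mul (analyticAt_cxFullOp_inv_entry T M hU r s)

/-- ★★ THE ENTRIES OF `Δ_eff(U,V)` ARE ANALYTIC on the locus. [cite: King1986, (2.14) p.653; Balaban1985BackgroundPropagators, Thm 3.4 p.400] -/
theorem analyticAt_cxEffLap_entry {a c m2 : ℝ} {UV₀ : CxLinks (fine L M) 𝕜 n} (hU : IsUnit (cxFullOp T M a c m2 UV₀.1 UV₀.2)) (p p' : Tor M × n) :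
    AnalyticAt 𝕜 (fun UV : CxLinks (fine L M) 𝕜 n => cxEffLap T M a c m2 UV.1 UV.2 p p') UV₀ := by
  unfold cxEffLap
  simp only [Matrix.sub_apply, Matrix.smul_apply, smul_eq_mul]
  exact analyticAt_const.sub (analyticAt_const.mul (analyticAt_cxSandwich_entry T M hU p p'))

/-- ★★★ **PRINT's ONE-VARIABLE `Δ_eff`: every entry of `U ↦ Δ_eff(U,U⁻¹)` is analytic at every `U` of the closed polydisc** `‖U_b − U₀_b‖ ≤ ε`, `Lε ≤ s₀(κ,a,d)` around a unitary `κ`-coercive `U₀`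
(King's scaling, comb-depth contours). [cite: King1986, (2.14) p.653, (4.34) p.674; Balaban1985BackgroundPropagators, Thm 3.4 p.400] -/
theorem analyticAt_printEffLap_entry (hD : ∀ j, T.depth j ≤ (d + 1) * (L - 1)) {a m2 : ℝ} (ha : 0 ≤ a) (hm : 0 ≤ m2) (hL : 1 ≤ L)
    {U₀ : Tor (fine L M) × Fin (d + 1) → Matrix n n 𝕜} (hU₀ : ∀ bd, U₀ bd ∈ Matrix.unitaryGroup n 𝕜) {κ : ℝ} (hκ : 0 < κ)
    (hcoer : ∀ v : Tor (fine L M) × n → 𝕜, κ * ∑ x, ‖fib (fine L M) v x‖ ^ 2 ≤ RCLike.re (star v ⬝ᵥ (fullOpU T M a ((L : ℝ) ^ 2) m2 U₀ *ᵥ v)))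
    {U : Tor (fine L M) × Fin (d + 1) → Matrix n n 𝕜} {ε : ℝ} (hε0 : 0 ≤ ε) (hU : ∀ bd, ‖U bd - U₀ bd‖ ≤ ε) (hrad : (L : ℝ) * ε ≤ sliceRadius κ a d) (p p' : Tor M × n) :
    AnalyticAt 𝕜 (fun W : Tor (fine L M) × Fin (d + 1) → Matrix n n 𝕜 => cxEffLap T M a ((L : ℝ) ^ 2) m2 W (fun bd => (W bd)⁻¹) p p') U := by
  have hε1 : ε < 1 := by
    have hL1 : (1 : ℝ) ≤ L := by exact_mod_cast hL
    have h := hrad.trans (sliceRadius_le κ a d).1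
    have hd : (4 : ℝ) ≤ 4 * ((d : ℝ) + 1) := by have : (0 : ℝ) ≤ d := Nat.cast_nonneg d; linarith
    have h2 : (L : ℝ) * ε ≤ 1 / 4 := h.trans (one_div_le_one_div_of_le (by norm_num) hd)
    nlinarith
  have hunit : ∀ bd, IsUnit (U bd) := fun bd => isUnit_of_near_unitary (hU₀ bd) (hU bd) hε1
  have hA : IsUnit (cxFullOp T M a ((L : ℝ) ^ 2) m2 U (fun bd => (U bd)⁻¹)) := isUnit_cxFullOp_at_radius T M hD ha hm hL hU₀ hκ hcoer hε0 hU hrad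
  have h := (analyticAt_cxEffLap_entry T M (UV₀ := ((U, fun bd => (U bd)⁻¹) : CxLinks (fine L M) 𝕜 n)) hA p p').comp_of_eq (analyticAt_sliceEmbed M hunit) rfl
  exact h

end Entries

/-! ## §2 The scalar bilinear entries along the complex line (`𝕜 = ℂ`) -/

section Line

variable {D' : ℕ} (hD : ∀ j, T.depth j ≤ (d + 1) * (L - 1)) {a m2 : ℝ} (ha : 0 ≤ a) (hm : 0 ≤ m2) (hL : 1 ≤ L)
variable {U₀ : Tor (fine L M) × Fin (d + 1) → Matrix n n ℂ} (hU₀ : ∀ bd, U₀ bd ∈ Matrix.unitaryGroup n ℂ) {κ : ℝ} (hκ : 0 < κ)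
  (hcoer : ∀ v : Tor (fine L M) × n → ℂ, κ * ∑ x, ‖fib (fine L M) v x‖ ^ 2 ≤ RCLike.re (star v ⬝ᵥ (fullOpU T M a ((L : ℝ) ^ 2) m2 U₀ *ᵥ v)))
variable {δU : Tor (fine L M) × Fin (d + 1) → Matrix n n ℂ} {ε R : ℝ} (hε0 : 0 ≤ ε) (hδU : ∀ bd, ‖δU bd‖ ≤ ε) (hR : 0 < R) (hrad : (L : ℝ) * (R * ε) ≤ sliceRadius κ a d)
include hD ha hm hL hU₀ hκ hcoer hε0 hδU hR hrad

omit hM hD ha hm hL hU₀ hκ hcoer hε0 hδU hR hrad [DecidableEq n] in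
/-- `⟨u, (blk S y y′)u′⟩ = Σ_{i,i′} ū_i·S((y,i),(y′,i′))·u′_{i′}`. [folklore] -/
theorem bilin_eq_sum (S : Matrix (Tor M × n) (Tor M × n) ℂ) (y y' : Tor M) (u u' : n → ℂ) :
    star u ⬝ᵥ (blk S y y' *ᵥ u') = ∑ i, ∑ i', star (u i) * (S (y, i) (y', i') * u' i') := by
  simp only [dotProduct, Matrix.mulVec, blk, Matrix.of_apply, Pi.star_apply, Finset.mul_sum]

/-- ★ THE SCALAR BILINEAR ENTRY ALONG THE LINE IS ℂ-DIFFERENTIABLE for `|t| ≤ R`. [cite: Balaban1985BackgroundPropagators, Thm 3.4 p.400] -/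
theorem differentiableAt_bilin_printLine {t : ℂ} (ht : ‖t‖ ≤ R) (y y' : Tor M) (u u' : n → ℂ) :
    DifferentiableAt ℂ (fun s : ℂ => star u ⬝ᵥ (blk (covQ T M (U₀ + s • δU) * (cxFullOp T M a ((L : ℝ) ^ 2) m2 (U₀ + s • δU) (fun bd => ((U₀ + s • δU) bd)⁻¹))⁻¹ * cxKingQadj T M (fun bd => ((U₀ + s • δU) bd)⁻¹)) y y' *ᵥ u')) t := by
  simp only [bilin_eq_sum]
  have hline : DifferentiableAt ℂ (fun s : ℂ => U₀ + s • δU) t := (differentiableAt_id.smul_const δU).const_add U₀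
  have hUt : ∀ bd, ‖(U₀ + t • δU) bd - U₀ bd‖ ≤ R * ε := fun bd => (norm_line_sub_le M hδU t bd).trans (mul_le_mul_of_nonneg_right ht hε0)
  have hε1 : R * ε < 1 := by
    have hL1 : (1 : ℝ) ≤ L := by exact_mod_cast hL
    have h := hrad.trans (sliceRadius_le κ a d).1
    have hd : (4 : ℝ) ≤ 4 * ((d : ℝ) + 1) := by have : (0 : ℝ) ≤ d := Nat.cast_nonneg d; linarith
    have h2 : (L : ℝ) * (R * ε) ≤ 1 / 4 := h.trans (one_div_le_one_div_of_le (by norm_num) hd)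
    nlinarith [mul_nonneg hR.le hε0]
  have hunit : ∀ bd, IsUnit ((U₀ + t • δU) bd) := fun bd => isUnit_of_near_unitary (hU₀ bd) (hUt bd) hε1
  have hA : IsUnit (cxFullOp T M a ((L : ℝ) ^ 2) m2 (U₀ + t • δU) (fun bd => ((U₀ + t • δU) bd)⁻¹)) :=
    isUnit_cxFullOp_at_radius T M hD ha hm hL hU₀ hκ hcoer (mul_nonneg hR.le hε0) hUt hrad
  have key : ∀ i i' : n, DifferentiableAt ℂ (fun s : ℂ => (covQ T M (U₀ + s • δU) * (cxFullOp T M a ((L : ℝ) ^ 2) m2 (U₀ + s • δU) (fun bd => ((U₀ + s • δU) bd)⁻¹))⁻¹ * cxKingQadj T M (fun bd => ((U₀ + s • δU) bd)⁻¹)) (y, i) (y', i')) t := by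
    intro i i'
    have hS := (analyticAt_cxSandwich_entry T M (UV₀ := ((U₀ + t • δU, fun bd => ((U₀ + t • δU) bd)⁻¹) : CxLinks (fine L M) ℂ n)) hA (y, i) (y', i')).comp_of_eq
      (analyticAt_sliceEmbed M hunit) rfl
    have e : (fun s : ℂ => (covQ T M (U₀ + s • δU) * (cxFullOp T M a ((L : ℝ) ^ 2) m2 (U₀ + s • δU) (fun bd => ((U₀ + s • δU) bd)⁻¹))⁻¹ * cxKingQadj T M (fun bd => ((U₀ + s • δU) bd)⁻¹)) (y, i) (y', i'))
        = ((fun UV : CxLinks (fine L M) ℂ n => (covQ T M UV.1 * (cxFullOp T M a ((L : ℝ) ^ 2) m2 UV.1 UV.2)⁻¹ * cxKingQadj T M UV.2) (y, i) (y', i'))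
            ∘ (fun U : Tor (fine L M) × Fin (d + 1) → Matrix n n ℂ => ((U, fun bd => (U bd)⁻¹) : CxLinks (fine L M) ℂ n))) ∘ (fun s : ℂ => U₀ + s • δU) := rfl
    rw [e]
    exact hS.differentiableAt.comp t hline
  have e : (fun s : ℂ => ∑ i, ∑ i', star (u i) * ((covQ T M (U₀ + s • δU) * (cxFullOp T M a ((L : ℝ) ^ 2) m2 (U₀ + s • δU) (fun bd => ((U₀ + s • δU) bd)⁻¹))⁻¹ * cxKingQadj T M (fun bd => ((U₀ + s • δU) bd)⁻¹)) (y, i) (y', i') * u' i'))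
      = ∑ i, ∑ i', (fun s : ℂ => star (u i) * ((covQ T M (U₀ + s • δU) * (cxFullOp T M a ((L : ℝ) ^ 2) m2 (U₀ + s • δU) (fun bd => ((U₀ + s • δU) bd)⁻¹))⁻¹ * cxKingQadj T M (fun bd => ((U₀ + s • δU) bd)⁻¹)) (y, i) (y', i') * u' i')) := by
    funext s; simp only [Finset.sum_apply]
  rw [e]
  exact DifferentiableAt.sum fun i _ => DifferentiableAt.sum fun i' _ => ((key i i').mul (differentiableAt_const _)).const_mul _

/-- ★ THE UNIFORM BOUND ON THE CLOSED DISC: `|⟨u, blk S(t) y y′ u′⟩| ≤ (8∕κ)e³e^{−ctRate(κ∕2,a,d)d_M(y,y′)}‖u‖‖u′‖` for `|t| ≤ R`. [cite: King1986, (4.34) p.674; Balaban1985BackgroundPropagators, Thm 3.4 p.400] -/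
theorem norm_bilin_printLine_le {t : ℂ} (ht : ‖t‖ ≤ R) (y y' : Tor M) (u u' : n → ℂ) :
    ‖star u ⬝ᵥ (blk (covQ T M (U₀ + t • δU) * (cxFullOp T M a ((L : ℝ) ^ 2) m2 (U₀ + t • δU) (fun bd => ((U₀ + t • δU) bd)⁻¹))⁻¹ * cxKingQadj T M (fun bd => ((U₀ + t • δU) bd)⁻¹)) y y' *ᵥ u')‖ ≤ 8 / κ * Real.exp 3 * Real.exp (-(ctRate (κ / 2) a d * tdistT M y y')) * ‖(toLp 2 u : EuclideanSpace ℂ n)‖ * ‖(toLp 2 u' : EuclideanSpace ℂ n)‖ := by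
  have hUt : ∀ bd, ‖(U₀ + t • δU) bd - U₀ bd‖ ≤ R * ε := fun bd => (norm_line_sub_le M hδU t bd).trans (mul_le_mul_of_nonneg_right ht hε0)
  have hS := norm_blk_cxSandwich_at_radius_le T M hD ha hm hL hU₀ hκ hcoer (mul_nonneg hR.le hε0) hUt hrad y y'
  calc ‖star u ⬝ᵥ (blk (covQ T M (U₀ + t • δU) * (cxFullOp T M a ((L : ℝ) ^ 2) m2 (U₀ + t • δU) (fun bd => ((U₀ + t • δU) bd)⁻¹))⁻¹ * cxKingQadj T M (fun bd => ((U₀ + t • δU) bd)⁻¹)) y y' *ᵥ u')‖ ≤ ‖(toLp 2 u : EuclideanSpace ℂ n)‖ * (‖blk (covQ T M (U₀ + t • δU) * (cxFullOp T M a ((L : ℝ) ^ 2) m2 (U₀ + t • δU) (fun bd => ((U₀ + t • δU) bd)⁻¹))⁻¹ * cxKingQadj T M (fun bd => ((U₀ + t • δU) bd)⁻¹)) y y'‖ * ‖(toLp 2 u' : EuclideanSpace ℂ n)‖) := norm_star_dotProduct_le_fibre u u' _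
    _ ≤ ‖(toLp 2 u : EuclideanSpace ℂ n)‖ * ((8 / κ * Real.exp 3 * Real.exp (-(ctRate (κ / 2) a d * tdistT M y y'))) * ‖(toLp 2 u' : EuclideanSpace ℂ n)‖) := by gcongr
    _ = _ := by ring

/-- ★★ **CAUCHY ON THE HALF DISC** for the scalar entry: `‖s‖ ≤ R∕2` ⟹ `|(d∕ds)⟨u, blk S(s) y y′ u′⟩| ≤ (8∕κ)e³e^{−δd_M}‖u‖‖u′‖∕(R∕2)`. [cite: Balaban1985BackgroundPropagators, Thm 3.4 p.400, (3.57) p.401] -/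
theorem norm_deriv_bilin_printLine_le {s : ℂ} (hs : ‖s‖ ≤ R / 2) (y y' : Tor M) (u u' : n → ℂ) :
    ‖deriv (fun s : ℂ => star u ⬝ᵥ (blk (covQ T M (U₀ + s • δU) * (cxFullOp T M a ((L : ℝ) ^ 2) m2 (U₀ + s • δU) (fun bd => ((U₀ + s • δU) bd)⁻¹))⁻¹ * cxKingQadj T M (fun bd => ((U₀ + s • δU) bd)⁻¹)) y y' *ᵥ u')) s‖
      ≤ (8 / κ * Real.exp 3 * Real.exp (-(ctRate (κ / 2) a d * tdistT M y y')) * ‖(toLp 2 u : EuclideanSpace ℂ n)‖ * ‖(toLp 2 u' : EuclideanSpace ℂ n)‖) / (R / 2) := by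
  have hR2 : 0 < R / 2 := by positivity
  refine Complex.norm_deriv_le_of_forall_mem_sphere_norm_le hR2 ?_ fun t ht => ?_
  · refine DifferentiableOn.diffContOnCl ?_
    rw [closure_ball s hR2.ne']
    intro t ht
    have hts : ‖t - s‖ ≤ R / 2 := by simpa only [mem_closedBall, dist_eq_norm] using ht
    have htR : ‖t‖ ≤ R := by
      calc ‖t‖ = ‖(t - s) + s‖ := by rw [sub_add_cancel]
        _ ≤ ‖t - s‖ + ‖s‖ := norm_add_le _ _
        _ ≤ R / 2 + R / 2 := add_le_add hts hs
        _ = R := by ring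
    exact (differentiableAt_bilin_printLine T M hD ha hm hL hU₀ hκ hcoer hε0 hδU hR hrad htR y y' u u').differentiableWithinAt
  · have hts : ‖t - s‖ = R / 2 := by simpa only [mem_sphere, dist_eq_norm] using ht
    have htR : ‖t‖ ≤ R := by
      calc ‖t‖ = ‖(t - s) + s‖ := by rw [sub_add_cancel]
        _ ≤ ‖t - s‖ + ‖s‖ := norm_add_le _ _
        _ ≤ R / 2 + R / 2 := add_le_add hts.le hs
        _ = R := by ring
    exact norm_bilin_printLine_le T M hD ha hm hL hU₀ hκ hcoer hε0 hδU hR hrad htR y y' u u'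

/-- ★★★ **THE SCALAR ENTRY ACROSS THE LINE**: for `R ≥ 2`, `|⟨u, blk(S(1) − S(0)) y y′ u′⟩| ≤ (16∕κ)e³e^{−δd_M(y,y′)}‖u‖‖u′‖∕R` (mean value on the unit disc).
[cite: Balaban1985BackgroundPropagators, Thm 3.4 p.400, (3.48)–(3.50) pp.398–400; King1986, (4.34) p.674] -/
theorem norm_bilin_printSandwich_sub_le (hR2 : 2 ≤ R) (y y' : Tor M) (u u' : n → ℂ) :
    ‖star u ⬝ᵥ (blk (covQ T M (U₀ + δU) * (cxFullOp T M a ((L : ℝ) ^ 2) m2 (U₀ + δU) (fun bd => ((U₀ + δU) bd)⁻¹))⁻¹ * cxKingQadj T M (fun bd => ((U₀ + δU) bd)⁻¹)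
        - covQ T M U₀ * (cxFullOp T M a ((L : ℝ) ^ 2) m2 U₀ (fun bd => (U₀ bd)⁻¹))⁻¹ * cxKingQadj T M (fun bd => (U₀ bd)⁻¹)) y y' *ᵥ u')‖
      ≤ 16 / κ * Real.exp 3 * Real.exp (-(ctRate (κ / 2) a d * tdistT M y y')) / R * ‖(toLp 2 u : EuclideanSpace ℂ n)‖ * ‖(toLp 2 u' : EuclideanSpace ℂ n)‖ := by
  set f : ℂ → ℂ := fun s => star u ⬝ᵥ (blk (covQ T M (U₀ + s • δU) * (cxFullOp T M a ((L : ℝ) ^ 2) m2 (U₀ + s • δU) (fun bd => ((U₀ + s • δU) bd)⁻¹))⁻¹ * cxKingQadj T M (fun bd => ((U₀ + s • δU) bd)⁻¹)) y y' *ᵥ u') with hf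
  set B : ℝ := 8 / κ * Real.exp 3 * Real.exp (-(ctRate (κ / 2) a d * tdistT M y y')) * ‖(toLp 2 u : EuclideanSpace ℂ n)‖ * ‖(toLp 2 u' : EuclideanSpace ℂ n)‖ with hB
  have hball : ∀ s ∈ closedBall (0 : ℂ) 1, ‖s‖ ≤ R / 2 := fun s hs => by
    have : ‖s‖ ≤ 1 := by simpa only [mem_closedBall, dist_zero_right] using hs
    linarith
  have hdiff : ∀ s ∈ closedBall (0 : ℂ) 1, DifferentiableAt ℂ f s := fun s hs =>
    differentiableAt_bilin_printLine T M hD ha hm hL hU₀ hκ hcoer hε0 hδU hR hrad ((hball s hs).trans (by linarith)) y y' u u'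
  have hbound : ∀ s ∈ closedBall (0 : ℂ) 1, ‖deriv f s‖ ≤ B / (R / 2) := fun s hs => norm_deriv_bilin_printLine_le T M hD ha hm hL hU₀ hκ hcoer hε0 hδU hR hrad (hball s hs) y y' u u'
  have h := (convex_closedBall (0 : ℂ) 1).norm_image_sub_le_of_norm_deriv_le hdiff hbound (x := 0) (y := 1)
    (mem_closedBall_self zero_le_one) (by rw [mem_closedBall, dist_zero_right, norm_one])
  have e1 : f 1 = star u ⬝ᵥ (blk (covQ T M (U₀ + δU) * (cxFullOp T M a ((L : ℝ) ^ 2) m2 (U₀ + δU) (fun bd => ((U₀ + δU) bd)⁻¹))⁻¹ * cxKingQadj T M (fun bd => ((U₀ + δU) bd)⁻¹)) y y' *ᵥ u') := by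
    simp only [hf, one_smul]
  have e0 : f 0 = star u ⬝ᵥ (blk (covQ T M U₀ * (cxFullOp T M a ((L : ℝ) ^ 2) m2 U₀ (fun bd => (U₀ bd)⁻¹))⁻¹ * cxKingQadj T M (fun bd => (U₀ bd)⁻¹)) y y' *ᵥ u') := by
    simp only [hf, zero_smul, add_zero]
  rw [blk_sub', Matrix.sub_mulVec, dotProduct_sub, ← e1, ← e0]
  calc ‖f 1 - f 0‖ ≤ B / (R / 2) * ‖(1 : ℂ) - 0‖ := h
    _ = 16 / κ * Real.exp 3 * Real.exp (-(ctRate (κ / 2) a d * tdistT M y y')) / R * ‖(toLp 2 u : EuclideanSpace ℂ n)‖ * ‖(toLp 2 u' : EuclideanSpace ℂ n)‖ := by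
        rw [sub_zero, norm_one, mul_one, hB]; ring

end Line

/-! ## §3 Unitary endpoints: King's (4.34)(ii), Lipschitz in the background with decay -/

section Lipschitz

variable (hD : ∀ j, T.depth j ≤ (d + 1) * (L - 1)) {a m2 : ℝ} (ha : 0 ≤ a) (hm : 0 ≤ m2) (hL : 1 ≤ L)
variable {U₀ U₁ : Tor (fine L M) × Fin (d + 1) → Matrix n n ℂ} (hU₀ : ∀ bd, U₀ bd ∈ Matrix.unitaryGroup n ℂ) (hU₁ : ∀ bd, U₁ bd ∈ Matrix.unitaryGroup n ℂ) {κ : ℝ} (hκ : 0 < κ)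
  (hcoer : ∀ v : Tor (fine L M) × n → ℂ, κ * ∑ x, ‖fib (fine L M) v x‖ ^ 2 ≤ RCLike.re (star v ⬝ᵥ (fullOpU T M a ((L : ℝ) ^ 2) m2 U₀ *ᵥ v)))
variable {ε : ℝ} (hε : 0 < ε) (hU : ∀ bd, ‖U₁ bd - U₀ bd‖ ≤ ε) (h2 : 2 * ((L : ℝ) * ε) ≤ sliceRadius κ a d)
include hD ha hm hL hU₀ hU₁ hκ hcoer hε hU h2

omit hD ha hm hL hU₁ hκ hcoer hε hU h2 in
/-- At a unitary field the continued sandwich is King's `Q(U)A₀(U)⁻¹Q(U)^*`. [cite: King1986, (2.14) p.653] -/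
theorem cxSandwich_inv_of_unitary :
    covQ T M U₀ * (cxFullOp T M a ((L : ℝ) ^ 2) m2 U₀ (fun bd => (U₀ bd)⁻¹))⁻¹ * cxKingQadj T M (fun bd => (U₀ bd)⁻¹)
      = covQ T M U₀ * (fullOpU T M a ((L : ℝ) ^ 2) m2 U₀)⁻¹ * kingQadjU T M U₀ := by
  have h : (fun bd => (U₀ bd)⁻¹) = fun bd => (U₀ bd)ᴴ := by
    funext bd
    have h1 : (U₀ bd)ᴴ * U₀ bd = 1 := by simpa only [star_eq_conjTranspose] using Matrix.mem_unitaryGroup_iff'.mp (hU₀ bd)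
    exact Matrix.inv_eq_left_inv h1
  rw [h, cxFullOp_adjoint, cxKingQadj_adjoint]

/-- ★★★ **THE SANDWICH IS LIPSCHITZ IN THE BACKGROUND WITH ITS BLOCK DECAY**: unitary `U₀, U₁` with `‖U₁ − U₀‖ ≤ ε`, `0 < ε`, `2Lε ≤ s₀(κ,a,d)`:
`‖blk (Q(U₁)A₀(U₁)⁻¹Q(U₁)^* − Q(U₀)A₀(U₀)⁻¹Q(U₀)^*) y y′‖ ≤ (16∕κ)e³·(Lε∕s₀(κ,a,d))·e^{−ctRate(κ∕2,a,d)·d_M(y,y′)}`. [cite: King1986, (2.14) p.653, (4.34) p.674; Balaban1985BackgroundPropagators, Thm 3.4 p.400, (3.48)–(3.50) pp.398–400] -/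
theorem norm_blk_sandwich_sub_le_eta_uniform (y y' : Tor M) :
    ‖blk (covQ T M U₁ * (fullOpU T M a ((L : ℝ) ^ 2) m2 U₁)⁻¹ * kingQadjU T M U₁ - covQ T M U₀ * (fullOpU T M a ((L : ℝ) ^ 2) m2 U₀)⁻¹ * kingQadjU T M U₀) y y'‖
      ≤ 16 / κ * Real.exp 3 * ((L : ℝ) * ε / sliceRadius κ a d) * Real.exp (-(ctRate (κ / 2) a d * tdistT M y y')) := by
  have hs0 : 0 < sliceRadius κ a d := sliceRadius_pos hκ ha d
  have hL0 : (0 : ℝ) < L := by exact_mod_cast hL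
  have hLε : 0 < (L : ℝ) * ε := mul_pos hL0 hε
  set R : ℝ := sliceRadius κ a d / ((L : ℝ) * ε) with hRdef
  have hR0 : 0 < R := div_pos hs0 hLε
  have hR2 : 2 ≤ R := by rw [hRdef, le_div_iff₀ hLε]; exact h2
  have hrad : (L : ℝ) * (R * ε) ≤ sliceRadius κ a d := by
    rw [hRdef, show (L : ℝ) * (sliceRadius κ a d / ((L : ℝ) * ε) * ε) = sliceRadius κ a d by field_simp]
  have hδU : ∀ bd, ‖(U₁ - U₀) bd‖ ≤ ε := fun bd => by rw [Pi.sub_apply]; exact hU bd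
  have hC : 0 ≤ 16 / κ * Real.exp 3 * ((L : ℝ) * ε / sliceRadius κ a d) * Real.exp (-(ctRate (κ / 2) a d * tdistT M y y')) := by positivity
  refine l2_opNorm_le_of_bilinear _ hC fun u u' => ?_
  have h := norm_bilin_printSandwich_sub_le T M hD ha hm hL hU₀ hκ hcoer hε.le hδU hR0 hrad hR2 y y' u u'
  rw [add_sub_cancel, cxSandwich_inv_of_unitary T M hU₁, cxSandwich_inv_of_unitary T M hU₀] at h
  refine h.trans (le_of_eq ?_)
  rw [hRdef]
  field_simp

/-- ★★★★ **KING's (4.34)(ii) IS LIPSCHITZ IN THE BACKGROUND ON BAŁABAN's SCALE, WITH ITS DECAY**: unitary `U₀, U₁`, `‖U₁_b − U₀_b‖ ≤ ε` on every bond, `0 < ε`, `2Lε ≤ s₀(κ,a,d)`, `A₀(U₀)`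
`κ`-coercive (King's scaling, comb-depth contours, `L ≥ 1`, `a, m² ≥ 0`): `‖blk (Δ_eff(U₁) − Δ_eff(U₀)) y y′‖ ≤ a²·(16∕κ)e³·(Lε∕s₀(κ,a,d))·e^{−ctRate(κ∕2,a,d)·d_M(y,y′)}` — linear in `ε∕η`, constants
and rate depending on `(κ,a,d)` only, one factor `e^{−ctRate}` per block of separation. [cite: King1986, (2.14) p.653, (4.34) p.674; Balaban1985BackgroundPropagators, Thm 3.1 p.397, Thm 3.4 p.400, (3.48)–(3.50) pp.398–400] -/
theorem norm_blk_effLapU_sub_le_eta_uniform (y y' : Tor M) :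
    ‖blk (effLapU T M a ((L : ℝ) ^ 2) m2 U₁ - effLapU T M a ((L : ℝ) ^ 2) m2 U₀) y y'‖
      ≤ a ^ 2 * (16 / κ * Real.exp 3 * ((L : ℝ) * ε / sliceRadius κ a d)) * Real.exp (-(ctRate (κ / 2) a d * tdistT M y y')) := by
  have hS := norm_blk_sandwich_sub_le_eta_uniform T M hD ha hm hL hU₀ hU₁ hκ hcoer hε hU h2 y y'
  rw [blk_sub', blk_effLapU T M m2 y y', blk_effLapU T M m2 y y', sub_sub_sub_cancel_left, ← smul_sub, norm_smul, RCLike.norm_ofReal, abs_of_nonneg (sq_nonneg a), norm_sub_rev,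
    ← blk_sub', mul_assoc]
  exact mul_le_mul_of_nonneg_left hS (sq_nonneg a)

end Lipschitz

/-- ★★★ **ON THE SMALL-CURVATURE CLASS ALL CONSTANTS ARE FUNCTIONS OF (m²,a,d,ε₀)**: comb, `L ≥ 2`, unitary `U₀` with `‖P_{U₀} − 1‖ ≤ ε₀∕L²`, `κ₀ = m² + min(a,(2(d+1))⁻¹) − (d+1)d²ε₀² > 0`,
unitary `U₁` with `‖U₁ − U₀‖ ≤ ε`, `0 < ε`, `2Lε ≤ s₀(κ₀,a,d)`:  `‖blk (Δ_eff(U₁) − Δ_eff(U₀)) y y′‖ ≤ a²(16∕κ₀)e³(Lε∕s₀(κ₀,a,d))e^{−ctRate(κ₀∕2,a,d)d_M(y,y′)}`.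
[cite: King1986, (4.34) p.674; Balaban1985BackgroundPropagators, Thm 3.1 p.397, (3.35) p.396, Thm 3.4 p.400] -/
theorem norm_blk_effLapU_sub_le_small_curvature (hL : 2 ≤ L) {a m2 : ℝ} (ha : 0 ≤ a) (hm : 0 ≤ m2) {U₀ U₁ : Tor (fine L M) × Fin (d + 1) → Matrix n n ℂ}
    (hU₀ : ∀ bd, U₀ bd ∈ Matrix.unitaryGroup n ℂ) (hU₁ : ∀ bd, U₁ bd ∈ Matrix.unitaryGroup n ℂ)
    {ε₀ : ℝ} (hP : ∀ (x : Tor (fine L M)) (κ ρ : Fin (d + 1)), ‖kingPlaq (fine L M) U₀ x κ ρ - 1‖ ≤ ε₀ / (L : ℝ) ^ 2)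
    (hκ₀ : 0 < m2 + min a (1 / (2 * ((d : ℝ) + 1))) - ((d : ℝ) + 1) * (d : ℝ) ^ 2 * ε₀ ^ 2)
    {ε : ℝ} (hε : 0 < ε) (hU : ∀ bd, ‖U₁ bd - U₀ bd‖ ≤ ε) (h2 : 2 * ((L : ℝ) * ε) ≤ sliceRadius (m2 + min a (1 / (2 * ((d : ℝ) + 1))) - ((d : ℝ) + 1) * (d : ℝ) ^ 2 * ε₀ ^ 2) a d)
    (y y' : Tor M) :
    ‖blk (effLapU (kingComb d L) M a ((L : ℝ) ^ 2) m2 U₁ - effLapU (kingComb d L) M a ((L : ℝ) ^ 2) m2 U₀) y y'‖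
      ≤ a ^ 2 * (16 / (m2 + min a (1 / (2 * ((d : ℝ) + 1))) - ((d : ℝ) + 1) * (d : ℝ) ^ 2 * ε₀ ^ 2) * Real.exp 3
          * ((L : ℝ) * ε / sliceRadius (m2 + min a (1 / (2 * ((d : ℝ) + 1))) - ((d : ℝ) + 1) * (d : ℝ) ^ 2 * ε₀ ^ 2) a d))
        * Real.exp (-(ctRate ((m2 + min a (1 / (2 * ((d : ℝ) + 1))) - ((d : ℝ) + 1) * (d : ℝ) ^ 2 * ε₀ ^ 2) / 2) a d * tdistT M y y')) :=
  norm_blk_effLapU_sub_le_eta_uniform (kingComb d L) M (kingComb_depth_le (d := d) (L := L)) ha hm (by omega) hU₀ hU₁ hκ₀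
    (re_quadForm_fullOpU_ge_uniform_of_small_curvature M hL a m2 hU₀ hP) hε hU h2 y y'

end Summit.QuantumFields.YangMills.BalabanUVNodes.N15KingModelRung.Analytic

end
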